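import Mathlib
import HarnessLib

/-!
# Route `PoloidalWindowDoor`, item `LrcModEntire` (stmt-NavierStokesRegularity-20428), (Q4) column — B-POLE: THE POLE ARGUMENT IN THE CURVATURE VARIABLE
# (class-free; ns-k2-port-2 g9 `Cruxes/LrcModEntire/TOWER-CLOSES-port2g9.md` §C, in the Laurent-free form of the LEAD memo `T2B-g17.md` §14)

Cell ns-regularity-ideate, LEAD-lineage seat ns-poloidal-K2-p3 g17 (`--supports stmt-NavierStokesRegularity-20428`).

SETTING.  `K₀ ⊆ ℝ` an infinite set of curvature values `κ = k(s)` (the image of an `s`-interval on which `k′ ≠ 0`), `W ⊆ ℝ` a set of heights with `W ∖ {0}` infinite,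
real functions `ξ, υ, Z` on `K₀` (`ξ = k″∘k⁻¹`, `υ = (k′)²∘k⁻¹`, `Z = −2𝔄∘k⁻¹`) and `c, c′, e₀, e₁, e₂, e₃` on `W` with `c ≠ 0` on `W`, satisfying the first integral (‡) of the
curvature tower with denominators cleared:
  (P)  `ξ(κ)·c′(m)(1−κm)² + υ(κ)·(3m c′(m)(1−κm) + 4c(m)) − Z(κ)·(1−κm)³ + (1−κm)³·(e₀(m) + e₁(m)κ + e₂(m)κ² + e₃(m)κ³) = 0`   (`κ ∈ K₀`, `m ∈ W`),
and three heights `m₁, m₂, m₃ ∈ W` whose Cramer determinant is not identically zero.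
* `cramer_second` — pure algebra: three linear relations `aᵢξ + bᵢυ − jᵢZ + qᵢ = 0` give `υ·det[a,b,−j] = det[a,−q,−j]` (and the analogues for `ξ`, `Z`).
* ★★ `pole_argument` — THEN `υ(κ) = 0` for some `κ ∈ K₀`.  (In the application `υ = (k′)² > 0` on `K₀`: contradiction ⇒ `k′ ≡ 0`, the branch is a line — port-2 g9 §C3/§D.)
PROOF (memo §14): Cramer in polynomial form (`D·υ = N_υ` on `K₀`), the fourth-height identity multiplied by `D` is a real polynomial in `κ` vanishing on the infinite set `K₀`,
hence zero; evaluated at the forbidden point `κ = 1/m` it gives `N_υ(1/m)·4c(m) = 0`; so `N_υ` has infinitely many roots, `N_υ = 0`, and `υ` vanishes off the finitely many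
roots of `D` in `K₀`.  No rational functions, no Laurent coefficients.

WHAT THIS IS NOT: not a claim about Navier–Stokes regularity and not a stub of the registry (twist_split v14, 5728777b85342204); class-free algebra for the research slots
`stub_Q4curvedAperiodic` / `stub_Q4sonicLineNegIsolated` (bears_on LADDER-NS N0 via item 20428).
-/

noncomputable section

set_option linter.dupNamespace false

namespace Summit.NavierStokesRegularity.NavierStokesRegularity.Theorems.PoloidalWindowDoorLrcModEntirePoleArgument

open Set Polynomial

/-- **Cramer for the second unknown** of three relations `aᵢξ + bᵢυ − jᵢZ + qᵢ = 0`. -/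
theorem cramer_second {ξ υ Z a₁ a₂ a₃ b₁ b₂ b₃ j₁ j₂ j₃ q₁ q₂ q₃ : ℝ}
    (h₁ : a₁ * ξ + b₁ * υ - j₁ * Z + q₁ = 0) (h₂ : a₂ * ξ + b₂ * υ - j₂ * Z + q₂ = 0) (h₃ : a₃ * ξ + b₃ * υ - j₃ * Z + q₃ = 0) :
    υ * (a₁ * (b₂ * (-j₃) - (-j₂) * b₃) - b₁ * (a₂ * (-j₃) - (-j₂) * a₃) + (-j₁) * (a₂ * b₃ - b₂ * a₃)) =
      a₁ * ((-q₂) * (-j₃) - (-j₂) * (-q₃)) - (-q₁) * (a₂ * (-j₃) - (-j₂) * a₃) + (-j₁) * (a₂ * (-q₃) - (-q₂) * a₃) := by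
  linear_combination (a₂ * j₃ - a₃ * j₂) * h₁ + (a₃ * j₁ - a₁ * j₃) * h₂ + (a₁ * j₂ - a₂ * j₁) * h₃

/-- **Cramer for the first unknown.** -/
theorem cramer_first {ξ υ Z a₁ a₂ a₃ b₁ b₂ b₃ j₁ j₂ j₃ q₁ q₂ q₃ : ℝ}
    (h₁ : a₁ * ξ + b₁ * υ - j₁ * Z + q₁ = 0) (h₂ : a₂ * ξ + b₂ * υ - j₂ * Z + q₂ = 0) (h₃ : a₃ * ξ + b₃ * υ - j₃ * Z + q₃ = 0) :
    ξ * (a₁ * (b₂ * (-j₃) - (-j₂) * b₃) - b₁ * (a₂ * (-j₃) - (-j₂) * a₃) + (-j₁) * (a₂ * b₃ - b₂ * a₃)) =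
      (-q₁) * (b₂ * (-j₃) - (-j₂) * b₃) - b₁ * ((-q₂) * (-j₃) - (-j₂) * (-q₃)) + (-j₁) * ((-q₂) * b₃ - b₂ * (-q₃)) := by
  linear_combination (j₂ * b₃ - b₂ * j₃) * h₁ + (b₁ * j₃ - j₁ * b₃) * h₂ + (j₁ * b₂ - b₁ * j₂) * h₃

/-- **Cramer for the third unknown.** -/
theorem cramer_third {ξ υ Z a₁ a₂ a₃ b₁ b₂ b₃ j₁ j₂ j₃ q₁ q₂ q₃ : ℝ}
    (h₁ : a₁ * ξ + b₁ * υ - j₁ * Z + q₁ = 0) (h₂ : a₂ * ξ + b₂ * υ - j₂ * Z + q₂ = 0) (h₃ : a₃ * ξ + b₃ * υ - j₃ * Z + q₃ = 0) :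
    Z * (a₁ * (b₂ * (-j₃) - (-j₂) * b₃) - b₁ * (a₂ * (-j₃) - (-j₂) * a₃) + (-j₁) * (a₂ * b₃ - b₂ * a₃)) =
      a₁ * (b₂ * (-q₃) - (-q₂) * b₃) - b₁ * (a₂ * (-q₃) - (-q₂) * a₃) + (-q₁) * (a₂ * b₃ - b₂ * a₃) := by
  linear_combination (a₂ * b₃ - b₂ * a₃) * h₁ + (b₁ * a₃ - a₁ * b₃) * h₂ + (a₁ * b₂ - b₁ * a₂) * h₃

/-- A real polynomial vanishing on an infinite set is zero. -/
theorem poly_eq_zero_of_eval_eq_zero_on {S : Set ℝ} (hS : S.Infinite) {p : ℝ[X]} (hp : ∀ x ∈ S, p.eval x = 0) : p = 0 := by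
  by_contra hne
  have hfin : (p.roots.toFinset : Set ℝ).Finite := Finset.finite_toSet _
  have hsub : S ⊆ (p.roots.toFinset : Set ℝ) := by
    intro x hx
    simp only [Multiset.mem_toFinset, Finset.mem_coe]
    exact (mem_roots hne).2 (hp x hx)
  exact hS (hfin.subset hsub)

/-- ★★ **THE POLE ARGUMENT.**  See the module docstring.  The Cramer determinant of the three heights is required to be non-zero at ONE real point (equivalently: not the
zero polynomial). -/
theorem pole_argument {K₀ W : Set ℝ} (hK₀ : K₀.Infinite) (hW : (W \ {0}).Infinite)
    (ξ υ Z c c' e₀ e₁ e₂ e₃ : ℝ → ℝ) (hc : ∀ m ∈ W, c m ≠ 0)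
    (hP : ∀ κ ∈ K₀, ∀ m ∈ W,
      ξ κ * (c' m * (1 - κ * m) ^ 2) + υ κ * (3 * m * c' m * (1 - κ * m) + 4 * c m) - Z κ * (1 - κ * m) ^ 3
        + (1 - κ * m) ^ 3 * (e₀ m + e₁ m * κ + e₂ m * κ ^ 2 + e₃ m * κ ^ 3) = 0)
    {m₁ m₂ m₃ : ℝ} (hm₁ : m₁ ∈ W) (hm₂ : m₂ ∈ W) (hm₃ : m₃ ∈ W)
    (hD : ∃ κ₀ : ℝ,
      (c' m₁ * (1 - κ₀ * m₁) ^ 2) * ((3 * m₂ * c' m₂ * (1 - κ₀ * m₂) + 4 * c m₂) * (-(1 - κ₀ * m₃) ^ 3)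
          - (-(1 - κ₀ * m₂) ^ 3) * (3 * m₃ * c' m₃ * (1 - κ₀ * m₃) + 4 * c m₃))
        - (3 * m₁ * c' m₁ * (1 - κ₀ * m₁) + 4 * c m₁) * ((c' m₂ * (1 - κ₀ * m₂) ^ 2) * (-(1 - κ₀ * m₃) ^ 3)
          - (-(1 - κ₀ * m₂) ^ 3) * (c' m₃ * (1 - κ₀ * m₃) ^ 2))
        + (-(1 - κ₀ * m₁) ^ 3) * ((c' m₂ * (1 - κ₀ * m₂) ^ 2) * (3 * m₃ * c' m₃ * (1 - κ₀ * m₃) + 4 * c m₃)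
          - (3 * m₂ * c' m₂ * (1 - κ₀ * m₂) + 4 * c m₂) * (c' m₃ * (1 - κ₀ * m₃) ^ 2)) ≠ 0) :
    ∃ κ ∈ K₀, υ κ = 0 := by
  -- the polynomials in κ attached to a height m
  let A : ℝ → ℝ[X] := fun m => C (c' m) * (1 - X * C m) ^ 2
  let B : ℝ → ℝ[X] := fun m => C (3 * m * c' m) * (1 - X * C m) + C (4 * c m)
  let Jc : ℝ → ℝ[X] := fun m => (1 - X * C m) ^ 3
  let Q : ℝ → ℝ[X] := fun m => (1 - X * C m) ^ 3 * (C (e₀ m) + C (e₁ m) * X + C (e₂ m) * X ^ 2 + C (e₃ m) * X ^ 3)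
  have hA : ∀ m κ, (A m).eval κ = c' m * (1 - κ * m) ^ 2 := by
    intro m κ; simp only [A, eval_mul, eval_C, eval_pow, eval_sub, eval_one, eval_X]
  have hB : ∀ m κ, (B m).eval κ = 3 * m * c' m * (1 - κ * m) + 4 * c m := by
    intro m κ; simp only [B, eval_mul, eval_C, eval_add, eval_sub, eval_one, eval_X]
  have hJ : ∀ m κ, (Jc m).eval κ = (1 - κ * m) ^ 3 := by
    intro m κ; simp only [Jc, eval_mul, eval_C, eval_pow, eval_sub, eval_one, eval_X]
  have hQ : ∀ m κ, (Q m).eval κ = (1 - κ * m) ^ 3 * (e₀ m + e₁ m * κ + e₂ m * κ ^ 2 + e₃ m * κ ^ 3) := by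
    intro m κ; simp only [Q, eval_mul, eval_C, eval_pow, eval_add, eval_sub, eval_one, eval_X]
  -- Cramer determinants (as polynomials), for the rows (A mᵢ, B mᵢ, −Jc mᵢ) and right-hand sides −Q mᵢ
  let det3 : ℝ[X] → ℝ[X] → ℝ[X] → ℝ[X] → ℝ[X] → ℝ[X] → ℝ[X] → ℝ[X] → ℝ[X] → ℝ[X] :=
    fun x₁ y₁ z₁ x₂ y₂ z₂ x₃ y₃ z₃ => x₁ * (y₂ * z₃ - z₂ * y₃) - y₁ * (x₂ * z₃ - z₂ * x₃) + z₁ * (x₂ * y₃ - y₂ * x₃)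
  let D : ℝ[X] := det3 (A m₁) (B m₁) (-Jc m₁) (A m₂) (B m₂) (-Jc m₂) (A m₃) (B m₃) (-Jc m₃)
  let Nξ : ℝ[X] := det3 (-Q m₁) (B m₁) (-Jc m₁) (-Q m₂) (B m₂) (-Jc m₂) (-Q m₃) (B m₃) (-Jc m₃)
  let Nυ : ℝ[X] := det3 (A m₁) (-Q m₁) (-Jc m₁) (A m₂) (-Q m₂) (-Jc m₂) (A m₃) (-Q m₃) (-Jc m₃)
  let NZ : ℝ[X] := det3 (A m₁) (B m₁) (-Q m₁) (A m₂) (B m₂) (-Q m₂) (A m₃) (B m₃) (-Q m₃)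
  -- the three relations at κ ∈ K₀, in the shape of the Cramer lemmas
  have hrel : ∀ κ ∈ K₀, ∀ m ∈ W, (A m).eval κ * ξ κ + (B m).eval κ * υ κ - (Jc m).eval κ * Z κ + (Q m).eval κ = 0 := by
    intro κ hκ m hm
    rw [hA, hB, hJ, hQ]
    linear_combination hP κ hκ m hm
  -- Cramer identities on K₀
  have hCυ : ∀ κ ∈ K₀, υ κ * D.eval κ = Nυ.eval κ := by
    intro κ hκ
    have h := cramer_second (hrel κ hκ m₁ hm₁) (hrel κ hκ m₂ hm₂) (hrel κ hκ m₃ hm₃)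
    simp only [D, Nυ, det3, eval_add, eval_sub, eval_mul, eval_neg]
    linear_combination h
  have hCξ : ∀ κ ∈ K₀, ξ κ * D.eval κ = Nξ.eval κ := by
    intro κ hκ
    have h := cramer_first (hrel κ hκ m₁ hm₁) (hrel κ hκ m₂ hm₂) (hrel κ hκ m₃ hm₃)
    simp only [D, Nξ, det3, eval_add, eval_sub, eval_mul, eval_neg]
    linear_combination h
  have hCZ : ∀ κ ∈ K₀, Z κ * D.eval κ = NZ.eval κ := by
    intro κ hκ
    have h := cramer_third (hrel κ hκ m₁ hm₁) (hrel κ hκ m₂ hm₂) (hrel κ hκ m₃ hm₃)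
    simp only [D, NZ, det3, eval_add, eval_sub, eval_mul, eval_neg]
    linear_combination h
  -- the fourth height: F_m := Nξ·A m + Nυ·B m − NZ·Jc m + D·Q m vanishes on K₀, hence is the zero polynomial
  have hF : ∀ m ∈ W, Nξ * A m + Nυ * B m - NZ * Jc m + D * Q m = 0 := by
    intro m hm
    refine poly_eq_zero_of_eval_eq_zero_on hK₀ (fun κ hκ => ?_)
    simp only [eval_add, eval_sub, eval_mul]
    rw [← hCξ κ hκ, ← hCυ κ hκ, ← hCZ κ hκ]
    have h := hrel κ hκ m hm
    linear_combination D.eval κ * h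
  -- evaluate at the forbidden point κ = 1/m (m ≠ 0): only the `4 c(m)` term of `B m` survives
  have hNυroot : ∀ m ∈ W \ {0}, Nυ.eval (1 / m) = 0 := by
    intro m hm
    obtain ⟨hmW, hm0⟩ := hm
    have hm0' : m ≠ 0 := hm0
    have h := congrArg (fun p : ℝ[X] => p.eval (1 / m)) (hF m hmW)
    simp only [eval_add, eval_sub, eval_mul, eval_zero, hA, hB, hJ, hQ] at h
    have h1 : (1 - 1 / m * m) = 0 := by rw [one_div_mul_cancel hm0']; exact sub_self 1
    rw [h1] at h
    simp only [zero_pow two_ne_zero, zero_pow three_ne_zero, mul_zero, zero_mul, add_zero, zero_add, sub_zero] at h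
    -- h : Nυ.eval (1/m) * (4 * c m) = 0  (up to ring normal form)
    have hc' : 4 * c m ≠ 0 := mul_ne_zero four_ne_zero (hc m hmW)
    have h' : Nυ.eval (1 / m) * (4 * c m) = 0 := by linear_combination h
    exact (mul_eq_zero.1 h').resolve_right hc'
  -- hence Nυ = 0 (infinitely many roots `1/m`)
  have hNυ : Nυ = 0 := by
    have hinj : Set.InjOn (fun m : ℝ => 1 / m) (W \ {0}) := fun a _ b _ hab => by
      simpa using hab
    have hinf : ((fun m : ℝ => 1 / m) '' (W \ {0})).Infinite := (hW.image hinj)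
    refine poly_eq_zero_of_eval_eq_zero_on hinf (fun x hx => ?_)
    obtain ⟨m, hm, rfl⟩ := hx
    exact hNυroot m hm
  -- D is not the zero polynomial, so it has a non-root in the infinite set K₀
  have hDne : D ≠ 0 := by
    obtain ⟨κ₀, hκ₀⟩ := hD
    intro hD0
    apply hκ₀
    have h := congrArg (fun p : ℝ[X] => p.eval κ₀) hD0
    simp only [D, det3, eval_add, eval_sub, eval_mul, eval_neg, eval_zero, hA, hB, hJ] at h
    linear_combination h
  have hfin : {κ : ℝ | D.eval κ = 0}.Finite := by
    have hsub : {κ : ℝ | D.eval κ = 0} ⊆ (D.roots.toFinset : Set ℝ) := by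
      intro κ hκ
      simp only [Multiset.mem_toFinset, Finset.mem_coe]
      exact (mem_roots hDne).2 hκ
    exact (Finset.finite_toSet _).subset hsub
  obtain ⟨κ, hκK, hκD⟩ : ∃ κ ∈ K₀, D.eval κ ≠ 0 := by
    obtain ⟨κ, hκ⟩ := (Set.Infinite.sdiff hK₀ hfin).nonempty
    exact ⟨κ, hκ.1, hκ.2⟩
  refine ⟨κ, hκK, ?_⟩
  have h := hCυ κ hκK
  rw [hNυ, eval_zero] at h
  exact (mul_eq_zero.1 h).resolve_right hκD

end Summit.NavierStokesRegularity.NavierStokesRegularity.Theorems.PoloidalWindowDoorLrcModEntirePoleArgument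

end
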